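import Literature.AlgebraicGeometry.Modules.SectionsExact
import Literature.AlgebraicGeometry.Modules.IsoOfSectionsOnBasis
import Mathlib.CategoryTheory.Abelian.Basic
import HarnessLib

/-!
# Epimorphic images with the same sectionwise kernels on affine opens are isomorphic

Topic `AlgebraicGeometry/Modules`; namespace `Literature.AlgebraicGeometry.Modules`.  THEOREMS ONLY (no definition, no instance,
no notation, no named fact, no `sorry`).  For a scheme `X` and morphisms of `𝒪_X`-modules `φ : P ⟶ Q`, `φ′ : P ⟶ Q′` out of the SAME
module `P`:

* `kernel_ι_comp_eq_zero_of_app` — if on every AFFINE open `V` the sectionwise kernel of `φ` is contained in that of `φ′`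
  (`φ_V s = 0 ⟹ φ′_V s = 0`), then `kernel.ι φ ≫ φ′ = 0` (sections of `kernel φ` are the sectionwise kernel, ★ `app_kernel_ι_app`;
  a section vanishing on the affine basis vanishes, ★ `eq_zero_of_map_eq_zero_on_basis`);
* `exists_comp_eq_of_app` — hence, if `φ` is an EPIMORPHISM, `φ′` factors (uniquely, `eq_of_comp_eq`) through `φ`: in the abelian
  category `X.Modules` an epi is the cokernel of its kernel (Mathlib `Abelian.epiDesc`);
* **`exists_iso_comp_eq_of_app_iff`** — if both are epimorphisms with the SAME sectionwise kernels on affine opens, there is an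
  isomorphism `e : Q ≅ Q′` under `P` (`φ ≫ e.hom = φ′`), unique as a morphism under `P`.

This is the rigidity half of «quotients of `P` ↔ subsheaves of `P`» [Hartshorne1977, II §5 (p. 109) with II Ex. 1.8 (p. 66)]; consumer: the identification `Q ≅ f^*𝒬` of a rank-`k`
quotient of `𝒪_T ⊗ M` with the pull-back of the universal quotient of the Grassmannian along its classifying morphism (cell
`hodgecm-mathlib` (h4) (Q3), `Motives/GrassmannianQuotientIsoPullback`).  Count-neutral Mathlib-side capital; nothing here is about
HC — HC_CM is proved only modulo the 7 printed citations until rung 0 closes.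
-/

noncomputable section

open CategoryTheory AlgebraicGeometry Limits TopologicalSpace Opposite

namespace Literature.AlgebraicGeometry.Modules

universe u

variable {X : Scheme.{u}} {P Q Q' : X.Modules} (φ : P ⟶ Q) (φ' : P ⟶ Q')

/-- **`kernel φ` maps to zero under `φ′`** when the sectionwise kernels of `φ` on affine opens lie in those of `φ′`.
[cite: Hartshorne1977, II Ex. 1.8 (p. 66)] -/
theorem kernel_ι_comp_eq_zero_of_app
    (h : ∀ (V : X.Opens), IsAffineOpen V → ∀ s : Γ(P, V), φ.app V s = 0 → φ'.app V s = 0) :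
    kernel.ι φ ≫ φ' = 0 := by
  refine Scheme.Modules.hom_ext _ _ fun U => ?_
  ext s
  rw [Scheme.Modules.Hom.comp_app, Scheme.Modules.Hom.zero_app, CategoryTheory.comp_apply]
  change φ'.app U ((kernel.ι φ).app U s) = 0
  refine eq_zero_of_map_eq_zero_on_basis X.isBasis_affineOpens _ fun V hV hVU => ?_
  rw [← app_presheaf_map, ← app_presheaf_map]
  exact h V hV _ (app_kernel_ι_app φ V _)

/-- **An epimorphism through which the sectionwise kernels pass factors every such `φ′`**: `∃ e, φ ≫ e = φ′`
(Mathlib `Abelian.epiDesc`: in the abelian category `X.Modules` an epi is the cokernel of its kernel).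
[cite: Hartshorne1977, II §5 (p. 109)] -/
theorem exists_comp_eq_of_app [Epi φ]
    (h : ∀ (V : X.Opens), IsAffineOpen V → ∀ s : Γ(P, V), φ.app V s = 0 → φ'.app V s = 0) :
    ∃ e : Q ⟶ Q', φ ≫ e = φ' :=
  ⟨Abelian.epiDesc φ φ' (kernel_ι_comp_eq_zero_of_app φ φ' h), Abelian.comp_epiDesc φ φ' _⟩

/-- Morphisms under `P` out of an epimorphic image are unique. [cite: Hartshorne1977, II §5 (p. 109)] -/
theorem eq_of_comp_eq [Epi φ] {e e' : Q ⟶ Q'} (he : φ ≫ e = φ') (he' : φ ≫ e' = φ') : e = e' :=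
  (cancel_epi φ).1 (he.trans he'.symm)

/-- `∃!` form of the factorisation through an epimorphism. [cite: Hartshorne1977, II §5 (p. 109)] -/
theorem existsUnique_comp_eq_of_app [Epi φ]
    (h : ∀ (V : X.Opens), IsAffineOpen V → ∀ s : Γ(P, V), φ.app V s = 0 → φ'.app V s = 0) :
    ∃! e : Q ⟶ Q', φ ≫ e = φ' := by
  obtain ⟨e, he⟩ := exists_comp_eq_of_app φ φ' h
  exact ⟨e, he, fun e' he' => eq_of_comp_eq φ φ' he' he⟩

/-- **TWO EPIMORPHIC IMAGES OF `P` WITH THE SAME SECTIONWISE KERNELS ON AFFINE OPENS ARE ISOMORPHIC UNDER `P`**: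
`∃ e : Q ≅ Q′, φ ≫ e.hom = φ′` (the two factorisations are mutually inverse by uniqueness).
[cite: Hartshorne1977, II §5 (p. 109)] -/
theorem exists_iso_comp_eq_of_app_iff [Epi φ] [Epi φ']
    (h : ∀ (V : X.Opens), IsAffineOpen V → ∀ s : Γ(P, V), φ.app V s = 0 ↔ φ'.app V s = 0) :
    ∃ e : Q ≅ Q', φ ≫ e.hom = φ' := by
  obtain ⟨e, he⟩ := exists_comp_eq_of_app φ φ' fun V hV s hs => (h V hV s).1 hs
  obtain ⟨e', he'⟩ := exists_comp_eq_of_app φ' φ fun V hV s hs => (h V hV s).2 hs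
  refine ⟨⟨e, e', ?_, ?_⟩, he⟩
  · exact (cancel_epi φ).1 (by rw [reassoc_of% he, he', Category.comp_id])
  · exact (cancel_epi φ').1 (by rw [reassoc_of% he', he, Category.comp_id])

/-- The isomorphism under `P` is unique (as a morphism under `P`) and its inverse is the factorisation the other way.
[cite: Hartshorne1977, II §5 (p. 109)] -/
theorem iso_inv_comp_eq (e : Q ≅ Q') (he : φ ≫ e.hom = φ') : φ' ≫ e.inv = φ := by
  rw [← he, Category.assoc, e.hom_inv_id, Category.comp_id]

end Literature.AlgebraicGeometry.Modules

end
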